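import Summits.QuantumFields.QCD.Theorems.QuarksAsStableActionStableActionBridgeStubOffDiagonalTensorDensity
import HarnessLib

/-!
# A COUNTABLE family of off-diagonal real tensor products is total in `⁰𝒮((ℝ⁴)ⁿ)`

Helper file for stub `stub_diagonalExtraction` (DE) of line `registered` (skeleton r5) of the crux
`Summit.QuantumFields.QCD.Theses.QuarksNoInfraredClause.ThinQCD` (item stmt-QuantumFields-17278): pure Schwartz-space
analysis, no QCD.

The landed totality theorem `stub_offDiagonalTensorDensity` (`…StubOffDiagonalTensorDensity.lean`) puts every
`F ∈ ⁰𝒮((ℝ⁴)ⁿ)` in the closure of the span of ALL off-diagonal real tensor products.  A diagonal-subsequence argument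
over test functions needs a COUNTABLE generating family (`exists_countable_total`).  The Fourier-box engine behind the
landed proof is already explicit: for a box `B` the approximants are the terms `B.charTerm Λ nn`, `nn ∈ ℤ^{n×4}`
(`mem_closure_span_charTerm`, the local density theorem `mem_closure_span_boxTensors` with its last step removed), each a
combination of the `2ⁿ` real tensors obtained by splitting every factor into real and imaginary parts
(`eq_sum_tensorFin_reIm`).  Running the landed proof with separations `δ = 1/(j+1)`, integer mesh vectors `β ∈ ℤ^{4n}`,
modes `nn ∈ ℤ^{n×4}` and subsets `t ⊆ Fin n` exhibits a countable total family of off-diagonal real tensor products.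
No definition is introduced: the generating family is a parameter of the intermediate lemmas and is produced
existentially at the end.

Refs: K. Osterwalder, R. Schrader, Comm. Math. Phys. 31 (1973) 83–112, §2; the Fourier-series proof is folklore.
-/

noncomputable section

open scoped SchwartzMap
open Filter Topology Set Complex
open Literature.MathematicalPhysics.AQFT Literature.MathematicalPhysics.QuantumLattice
open Summit.QuantumFields.YangMills.Cruxes.OSLegsAtWeakCouplingC.Sketch (Separated
  exists_separated_tendsto_of_isOffDiagonal)
open Summit.QuantumFields.QCD.Cruxes.StableActionBridge.Sketch (offDiag_boxTensors_subset)

namespace Summit.QuantumFields.QCD.Cruxes.ThinQCD.Registered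

/-! ### The local density theorem with explicit approximants -/

section CharTerm

variable {E : Type*} [NormedAddCommGroup E] [NormedSpace ℝ E] [FiniteDimensional ℝ E]
variable {m n : ℕ} (Λ : E ≃L[ℝ] EuclideanSpace ℝ (Fin m))

/-- **Local density theorem, explicit form.**  If `tsupport F` lies in the inner box of `B : BoxData n m`, then `F`
belongs to the closure of the span of the COUNTABLY many Fourier terms `B.charTerm Λ nn`, `nn ∈ ℤ^{n×m}` (the proof of
`mem_closure_span_boxTensors` stops one step earlier). [folklore] -/
theorem mem_closure_span_charTerm (B : BoxData n m) (F : 𝓢((Fin n → E), ℂ))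
    (hF : tsupport (F : (Fin n → E) → ℂ) ⊆
      {v | ∀ ic : Fin n × Fin m, (Λ (v ic.1)) ic.2 ∈ Icc (B.l' ic) (B.u' ic)}) :
    F ∈ closure (Submodule.span ℂ (Set.range (B.charTerm Λ)) : Set 𝓢((Fin n → E), ℂ)) := by
  -- adapted from `Literature.MathematicalPhysics.QuantumLattice.mem_closure_span_boxTensors`
  obtain ⟨δ, hδ, hδ1, hδ2⟩ := B.exists_margin
  have hG : ∀ v ∈ tsupport (F : (Fin n → E) → ℂ), ∀ ic,
      (boxCoord Λ B.l B.u B.hlu v + boxShift B.l B.u) ic ∈ Icc δ (1 - δ) := by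
    intro v hv ic
    rw [boxCoord_add_boxShift_apply]
    exact div_mem_Icc_of_margin (B.hlu ic) (hδ1 ic) (hδ2 ic) (hF hv ic)
  have hP1 : ∀ v ∈ tsupport (F : (Fin n → E) → ℂ), B.cutoff Λ v = 1 := fun v hv =>
    B.cutoff_eq_one Λ fun ic => hF hv ic
  have hP0 : ∀ v ∈ tsupport (B.cutoff Λ : (Fin n → E) → ℂ), ∀ ic,
      (boxCoord Λ B.l B.u B.hlu v + boxShift B.l B.u) ic ∈ Icc (0 : ℝ) 1 := by
    intro v hv ic
    rw [boxCoord_add_boxShift_apply]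
    exact div_mem_Icc_zero_one (B.hlu ic) (B.K_subset_Icc ic (B.tsupport_cutoff_subset Λ hv ic))
  have hlim := tendsto_sum_boxCoeff_smul (boxCoord Λ B.l B.u B.hlu) (boxShift B.l B.u) hδ F
    (B.cutoff Λ) hG hP1 hP0 (B.charTerm Λ) (B.charTerm_apply Λ)
  refine mem_closure_of_tendsto hlim (Eventually.of_forall fun s => ?_)
  exact Submodule.sum_mem _ fun nn _ => Submodule.smul_mem _ _ (Submodule.subset_span ⟨nn, rfl⟩)

omit [FiniteDimensional ℝ E] in
/-- Each of the `2ⁿ` real/imaginary split tensors of a Fourier term `B.charTerm Λ nn` (pattern `t ⊆ Fin n`: real parts on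
`t`, imaginary parts off `t`) is a box tensor of `B` — its factors live in the blocks of the outer box. [folklore] -/
theorem reImSplit_mem_boxTensors (B : BoxData n m) (nn : Fin n × Fin m → ℤ) (t : Finset (Fin n)) :
    SchwartzMap.tensorFin n (fun i =>
        ofRealTest (if i ∈ t then reTest (B.charFactorS Λ nn i) else imTest (B.charFactorS Λ nn i))) ∈
      B.boxTensors Λ := by
  -- adapted from `BoxData.charTerm_mem_span`
  refine ⟨fun i => if i ∈ t then reTest (B.charFactorS Λ nn i) else imTest (B.charFactorS Λ nn i),
    fun i => ?_, isTensorOf_tensorFin _⟩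
  have hblock : B.blockK Λ i ⊆ {x | ∀ c, (Λ x) c ∈ Ioo (B.l (i, c)) (B.u (i, c))} :=
    fun x hx c => B.K_subset_Ioo (i, c) (hx c)
  have hq : tsupport (B.charFactorS Λ nn i : E → ℂ) ⊆ B.blockK Λ i := B.tsupport_charFactor_subset Λ nn i
  dsimp only
  split_ifs
  · exact ((tsupport_reTest_subset _).trans hq).trans hblock
  · exact ((tsupport_imTest_subset _).trans hq).trans hblock

omit [FiniteDimensional ℝ E] in
/-- The Fourier term is a combination of its `2ⁿ` real/imaginary split tensors. [folklore] -/
theorem charTerm_mem_span_reImSplit (B : BoxData n m) (nn : Fin n × Fin m → ℤ) :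
    B.charTerm Λ nn ∈ Submodule.span ℂ (Set.range fun t : Finset (Fin n) => SchwartzMap.tensorFin n (fun i =>
      ofRealTest (if i ∈ t then reTest (B.charFactorS Λ nn i) else imTest (B.charFactorS Λ nn i)))) := by
  have h := eq_sum_tensorFin_reIm (fun i => B.charFactorS Λ nn i) (B.charTerm Λ nn) (isTensorOf_tensorFin _)
  rw [h]
  exact Submodule.sum_mem _ fun t _ => Submodule.smul_mem _ _ (Submodule.subset_span ⟨t, rfl⟩)

end CharTerm

/-! ### Totality of families containing the off-diagonal split tensors of the mesh boxes -/

/-- **One piece of the lattice partition of a separated test function.**  Let `0 < h`, `12 h < δ`, `β ∈ ℤ^{4n}` and let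
`B` be the nested boxes with inner box `∏ [(β_{ic} - 1) h, (β_{ic} + 1) h]` and outer box
`∏ ((β_{ic} - 2) h, (β_{ic} + 2) h)`.  If the family `𝒢` contains every OFF-DIAGONAL real/imaginary split tensor of the
Fourier terms of `B` (identity coordinates on `ℝ⁴`), then for `tsupport u ⊆ Separated n δ` the piece `η_β · u` (`η_β` the
lattice bump in the mesh coordinates at scale `h`) lies in the closure of the span of `𝒢`: unless the piece vanishes, the
outer blocks are pairwise disjoint (a point of `supp u` in the box has particle coordinates `≥ δ > 12 h` apart), so all split
tensors of `B` are off-diagonal and the explicit local density theorem applies. [folklore] -/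
theorem piece_mem_closure_span {n : ℕ} {𝒢 : Set 𝓢((Fin n → (EuclideanSpace ℝ (Fin 4))), ℂ)} {h δ : ℝ} (hh : 0 < h) (hhδ : 12 * h < δ)
    (β : Fin (n * 4) → ℤ) (B : BoxData n 4)
    (hBl : ∀ ic, B.l ic = ((β (finProdFinEquiv ic) : ℤ) : ℝ) * h - 2 * h)
    (hBu : ∀ ic, B.u ic = ((β (finProdFinEquiv ic) : ℤ) : ℝ) * h + 2 * h)
    (hBl' : ∀ ic, B.l' ic = ((β (finProdFinEquiv ic) : ℤ) : ℝ) * h - h)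
    (hBu' : ∀ ic, B.u' ic = ((β (finProdFinEquiv ic) : ℤ) : ℝ) * h + h)
    (h𝒢 : ∀ (nn : Fin n × Fin 4 → ℤ) (t : Finset (Fin n)),
      IsOffDiagonal (SchwartzMap.tensorFin n (fun i => ofRealTest (if i ∈ t
        then reTest (B.charFactorS (ContinuousLinearEquiv.refl ℝ (EuclideanSpace ℝ (Fin 4))) nn i)
        else imTest (B.charFactorS (ContinuousLinearEquiv.refl ℝ (EuclideanSpace ℝ (Fin 4))) nn i)))) →
      SchwartzMap.tensorFin n (fun i => ofRealTest (if i ∈ t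
        then reTest (B.charFactorS (ContinuousLinearEquiv.refl ℝ (EuclideanSpace ℝ (Fin 4))) nn i)
        else imTest (B.charFactorS (ContinuousLinearEquiv.refl ℝ (EuclideanSpace ℝ (Fin 4))) nn i))) ∈ 𝒢)
    {u : 𝓢((Fin n → (EuclideanSpace ℝ (Fin 4))), ℂ)} (hu : tsupport (u : (Fin n → (EuclideanSpace ℝ (Fin 4))) → ℂ) ⊆ Separated n δ) :
    SchwartzMap.smulLeftCLM ℂ (fun y => ((latticeBump (meshCoord n 4 h hh) β y : ℝ) : ℂ)) u ∈
      closure ((Submodule.span ℂ 𝒢 : Submodule ℂ 𝓢((Fin n → (EuclideanSpace ℝ (Fin 4))), ℂ)) : Set 𝓢((Fin n → (EuclideanSpace ℝ (Fin 4))), ℂ)) := by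
  -- adapted from `Summit.QuantumFields.QCD.Cruxes.StableActionBridge.Sketch.offDiag_piece_mem_closure`
  set G := SchwartzMap.smulLeftCLM ℂ (fun y => ((latticeBump (meshCoord n 4 h hh) β y : ℝ) : ℂ)) u with hG
  -- the box of `β` in the coordinates `v_i^c`
  obtain ⟨b, hb⟩ : ∃ b : Fin n × Fin 4 → ℝ, ∀ ic, b ic = ((β (finProdFinEquiv ic) : ℤ) : ℝ) :=
    ⟨_, fun _ => rfl⟩
  have hbox : ∀ v ∈ tsupport (G : (Fin n → (EuclideanSpace ℝ (Fin 4))) → ℂ), ∀ ic : Fin n × Fin 4,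
      b ic * h - h ≤ v ic.1 ic.2 ∧ v ic.1 ic.2 ≤ b ic * h + h := by
    intro v hv ic
    have h1 := (SchwartzMap.tsupport_smulLeftCLM_subset (F := ℂ) _ u hv).2
    rw [tsupport_latticeBumpC (meshCoord n 4 h hh) β] at h1
    have h2 := tsupport_latticeBump_subset (meshCoord n 4 h hh) β h1 (finProdFinEquiv ic)
    rw [meshCoord_apply, mem_Icc, ← hb ic] at h2
    constructor
    · have h3 : b ic - 1 ≤ v ic.1 ic.2 / h := by linarith [h2.1]
      rw [le_div_iff₀ hh] at h3
      linarith
    · have h3 : v ic.1 ic.2 / h ≤ b ic + 1 := by linarith [h2.2]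
      rw [div_le_iff₀ hh] at h3
      linarith
  -- the zero piece
  by_cases hG0 : G = 0
  · rw [hG0]
    exact subset_closure (Submodule.zero_mem _)
  -- otherwise a point of the support of `u` lies in the box
  obtain ⟨v, hv⟩ : ∃ v, G v ≠ 0 := by
    by_contra hcon
    push Not at hcon
    exact hG0 (SchwartzMap.ext hcon)
  have hvbox := hbox v (subset_tsupport _ hv)
  have huv : u v ≠ 0 := by
    rw [hG, SchwartzMap.smulLeftCLM_apply_apply (hasTemperateGrowth_latticeBumpC (meshCoord n 4 h hh) β)] at hv
    exact right_ne_zero_of_smul hv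
  have hsep : ∀ i i' : Fin n, i ≠ i' → δ ≤ dist (v i) (v i') := hu (subset_tsupport _ huv)
  let Λ₀ : (EuclideanSpace ℝ (Fin 4)) ≃L[ℝ] (EuclideanSpace ℝ (Fin 4)) := ContinuousLinearEquiv.refl ℝ _
  have hF' : tsupport (G : (Fin n → (EuclideanSpace ℝ (Fin 4))) → ℂ) ⊆
      {v | ∀ ic : Fin n × Fin 4, (Λ₀ (v ic.1)) ic.2 ∈ Icc (B.l' ic) (B.u' ic)} := by
    intro v hv ic
    have h1 := hbox v hv ic
    refine ⟨?_, ?_⟩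
    · calc B.l' ic = b ic * h - h := by rw [hBl', hb]
        _ ≤ v ic.1 ic.2 := h1.1
    · calc (Λ₀ (v ic.1)) ic.2 = v ic.1 ic.2 := rfl
        _ ≤ b ic * h + h := h1.2
        _ = B.u' ic := by rw [hBu', hb]
  -- the outer blocks are pairwise disjoint
  have hdisj : ∀ i i' : Fin n, i ≠ i' →
      Disjoint {x : (EuclideanSpace ℝ (Fin 4)) | ∀ c, (Λ₀ x) c ∈ Ioo (B.l (i, c)) (B.u (i, c))}
        {x : (EuclideanSpace ℝ (Fin 4)) | ∀ c, (Λ₀ x) c ∈ Ioo (B.l (i', c)) (B.u (i', c))} := by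
    intro i i' hii'
    refine Set.disjoint_left.2 fun y hyi hyj => ?_
    have hc : ∀ c, |(v i - v i') c| ≤ 6 * h := fun c => by
      have h1 : B.l (i, c) < y c ∧ y c < B.u (i, c) := hyi c
      have h2 : B.l (i', c) < y c ∧ y c < B.u (i', c) := hyj c
      rw [hBl, hBu, ← hb] at h1 h2
      have h3 := hvbox (i, c)
      have h4 := hvbox (i', c)
      dsimp only at h3 h4
      rw [PiLp.sub_apply, abs_le]
      constructor <;> linarith [h1.1, h1.2, h2.1, h2.2, h3.1, h3.2, h4.1, h4.2]
    have hdist : dist (v i) (v i') ≤ 12 * h := by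
      have h0 := EuclideanSpace.norm_le_sqrt_card_mul (v i - v i') (by positivity : (0 : ℝ) ≤ 6 * h) hc
      rw [Fintype.card_fin, show ((4 : ℕ) : ℝ) = 2 ^ 2 by norm_num, Real.sqrt_sq (by norm_num)] at h0
      rw [dist_eq_norm]
      linarith
    have h5 := hsep i i' hii'
    linarith
  -- every split tensor of this box is off-diagonal, hence in `𝒢`
  have hgen : Set.range (B.charTerm Λ₀) ⊆ (Submodule.span ℂ 𝒢 : Set 𝓢((Fin n → (EuclideanSpace ℝ (Fin 4))), ℂ)) := by
    rintro _ ⟨nn, rfl⟩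
    refine Submodule.span_mono ?_ (charTerm_mem_span_reImSplit Λ₀ B nn)
    rintro _ ⟨t, rfl⟩
    exact h𝒢 nn t (offDiag_boxTensors_subset Λ₀ B hdisj (reImSplit_mem_boxTensors Λ₀ B nn t)).2
  have hspan : (Submodule.span ℂ (Set.range (B.charTerm Λ₀)) : Set 𝓢((Fin n → (EuclideanSpace ℝ (Fin 4))), ℂ)) ⊆
      (Submodule.span ℂ 𝒢 : Set 𝓢((Fin n → (EuclideanSpace ℝ (Fin 4))), ℂ)) :=
    Submodule.span_le.2 hgen
  exact closure_mono hspan (mem_closure_span_charTerm Λ₀ B G hF')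

/-- **A `δ`-separated test function lies in the closed span of `𝒢`** provided `𝒢` contains, for every mesh vector
`β ∈ ℤ^{4n}` and every choice `B` of the nested boxes of `β` at mesh `h = δ/24`, the off-diagonal split tensors of `B`: the
lattice partition of unity at mesh `δ/24` converges on Schwartz space and every piece lies in the closed span. [folklore] -/
theorem mem_closure_span_of_separated {n : ℕ} {𝒢 : Set 𝓢((Fin n → (EuclideanSpace ℝ (Fin 4))), ℂ)} {δ : ℝ} (hδ : 0 < δ)
    (h𝒢 : ∀ (β : Fin (n * 4) → ℤ) (B : BoxData n 4),
      (∀ ic, B.l ic = ((β (finProdFinEquiv ic) : ℤ) : ℝ) * (δ / 24) - 2 * (δ / 24)) →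
      (∀ ic, B.u ic = ((β (finProdFinEquiv ic) : ℤ) : ℝ) * (δ / 24) + 2 * (δ / 24)) →
      (∀ ic, B.l' ic = ((β (finProdFinEquiv ic) : ℤ) : ℝ) * (δ / 24) - (δ / 24)) →
      (∀ ic, B.u' ic = ((β (finProdFinEquiv ic) : ℤ) : ℝ) * (δ / 24) + (δ / 24)) →
      ∀ (nn : Fin n × Fin 4 → ℤ) (t : Finset (Fin n)),
        IsOffDiagonal (SchwartzMap.tensorFin n (fun i => ofRealTest (if i ∈ t
          then reTest (B.charFactorS (ContinuousLinearEquiv.refl ℝ (EuclideanSpace ℝ (Fin 4))) nn i)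
          else imTest (B.charFactorS (ContinuousLinearEquiv.refl ℝ (EuclideanSpace ℝ (Fin 4))) nn i)))) →
        SchwartzMap.tensorFin n (fun i => ofRealTest (if i ∈ t
          then reTest (B.charFactorS (ContinuousLinearEquiv.refl ℝ (EuclideanSpace ℝ (Fin 4))) nn i)
          else imTest (B.charFactorS (ContinuousLinearEquiv.refl ℝ (EuclideanSpace ℝ (Fin 4))) nn i))) ∈ 𝒢)
    {u : 𝓢((Fin n → (EuclideanSpace ℝ (Fin 4))), ℂ)} (hu : tsupport (u : (Fin n → (EuclideanSpace ℝ (Fin 4))) → ℂ) ⊆ Separated n δ) :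
    u ∈ closure ((Submodule.span ℂ 𝒢 : Submodule ℂ 𝓢((Fin n → (EuclideanSpace ℝ (Fin 4))), ℂ)) : Set 𝓢((Fin n → (EuclideanSpace ℝ (Fin 4))), ℂ)) := by
  -- adapted from `Summit.QuantumFields.QCD.Cruxes.StableActionBridge.Sketch.offDiag_mem_closure_of_separated`
  have hC : IsClosed (closure ((Submodule.span ℂ 𝒢 : Submodule ℂ 𝓢((Fin n → (EuclideanSpace ℝ (Fin 4))), ℂ)) :
      Set 𝓢((Fin n → (EuclideanSpace ℝ (Fin 4))), ℂ))) := isClosed_closure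
  have hh : (0 : ℝ) < δ / 24 := by positivity
  set Λ := meshCoord n 4 (δ / 24) hh
  have hlim : Tendsto (fun R : ℕ => ∑ β ∈ latticeCube (n * 4) R,
      SchwartzMap.smulLeftCLM ℂ (fun y => ((latticeBump Λ β y : ℝ) : ℂ)) u) atTop (𝓝 u) := by
    have hsum : ∀ R : ℕ, ∑ β ∈ latticeCube (n * 4) R,
        SchwartzMap.smulLeftCLM ℂ (fun y => ((latticeBump Λ β y : ℝ) : ℂ)) u =
          SchwartzMap.smulLeftCLM ℂ (fun y => ((latticeWindow Λ R y : ℝ) : ℂ)) u := by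
      intro R
      have hW : (fun y => ((latticeWindow Λ R y : ℝ) : ℂ)) =
          fun y => ∑ β ∈ latticeCube (n * 4) R, ((latticeBump Λ β y : ℝ) : ℂ) := by
        funext y
        rw [← sum_latticeCube_latticeBump Λ R y, Complex.ofReal_sum]
      rw [hW, SchwartzMap.smulLeftCLM_sum fun β _ => hasTemperateGrowth_latticeBumpC Λ β,
        FunLike.coe_sum, Finset.sum_apply]
    simp_rw [hsum]
    exact tendsto_latticeWindow_smul Λ ℂ u
  refine hC.mem_of_tendsto hlim (Eventually.of_forall fun R => ?_)
  refine (Submodule.span ℂ 𝒢).topologicalClosure.sum_mem fun β _ => ?_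
  -- the nested boxes of `β`
  let B : BoxData n 4 :=
    { l := fun ic => ((β (finProdFinEquiv ic) : ℤ) : ℝ) * (δ / 24) - 2 * (δ / 24)
      u := fun ic => ((β (finProdFinEquiv ic) : ℤ) : ℝ) * (δ / 24) + 2 * (δ / 24)
      l' := fun ic => ((β (finProdFinEquiv ic) : ℤ) : ℝ) * (δ / 24) - (δ / 24)
      u' := fun ic => ((β (finProdFinEquiv ic) : ℤ) : ℝ) * (δ / 24) + (δ / 24)
      hl := fun ic => by linarith, hl' := fun ic => by linarith, hu := fun ic => by linarith }
  exact piece_mem_closure_span hh (by linarith) β B (fun _ => rfl) (fun _ => rfl) (fun _ => rfl) (fun _ => rfl)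
    (h𝒢 β B (fun _ => rfl) (fun _ => rfl) (fun _ => rfl) (fun _ => rfl)) hu

/-- `Separated n` is antitone in the separation. [folklore] -/
theorem separated_anti {n : ℕ} {δ δ' : ℝ} (h : δ' ≤ δ) : Separated n δ ⊆ Separated n δ' :=
  fun _ hx i i' hii' => h.trans (hx i i' hii')

/-- **A COUNTABLE family of off-diagonal real tensor products is total in `⁰𝒮((ℝ⁴)ⁿ)`**: there is a countable set `𝒢` of
off-diagonal real tensor products such that every off-diagonal `F` lies in the closure of the span of `𝒢`.  Take for
`𝒢` the off-diagonal split tensors of the Fourier terms of the nested boxes of all mesh vectors `β ∈ ℤ^{4n}` at all meshes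
`δⱼ/24`, `δⱼ = 1/(j+1)` (countably many: index `(j, β, nn, t)`).  `F` is the Schwartz limit of `u_m` supported at pairwise
distances `≥ δ_m > 0` (`exists_separated_tendsto_of_isOffDiagonal`); `δ_m ≥ δⱼ` for some `j`, so `u_m` is `δⱼ`-separated and
lies in the closed span by `mem_closure_span_of_separated`. [folklore] -/
theorem exists_countable_total :
    ∀ n : ℕ, ∃ 𝒢 : Set (SchwartzMap (Fin n → EuclideanSpace ℝ (Fin 4)) ℂ), 𝒢.Countable ∧
      (∀ G ∈ 𝒢, G ∈ tensorProducts n ∧ IsOffDiagonal G) ∧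
      ∀ F : SchwartzMap (Fin n → EuclideanSpace ℝ (Fin 4)) ℂ, IsOffDiagonal F →
        F ∈ closure ((Submodule.span ℂ 𝒢 : Submodule ℂ (SchwartzMap (Fin n → EuclideanSpace ℝ (Fin 4)) ℂ)) :
          Set (SchwartzMap (Fin n → EuclideanSpace ℝ (Fin 4)) ℂ)) := by
  intro n
  classical
  -- the nested boxes of `β` at mesh `δⱼ / 24`, `δⱼ = 1/(j+1)`
  let box : ℕ → (Fin (n * 4) → ℤ) → BoxData n 4 := fun j β =>
    { l := fun ic => ((β (finProdFinEquiv ic) : ℤ) : ℝ) * (1 / ((j : ℝ) + 1) / 24) - 2 * (1 / ((j : ℝ) + 1) / 24)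
      u := fun ic => ((β (finProdFinEquiv ic) : ℤ) : ℝ) * (1 / ((j : ℝ) + 1) / 24) + 2 * (1 / ((j : ℝ) + 1) / 24)
      l' := fun ic => ((β (finProdFinEquiv ic) : ℤ) : ℝ) * (1 / ((j : ℝ) + 1) / 24) - (1 / ((j : ℝ) + 1) / 24)
      u' := fun ic => ((β (finProdFinEquiv ic) : ℤ) : ℝ) * (1 / ((j : ℝ) + 1) / 24) + (1 / ((j : ℝ) + 1) / 24)
      hl := fun ic => by
        have : (0 : ℝ) < 1 / ((j : ℝ) + 1) / 24 := by positivity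
        linarith
      hl' := fun ic => by
        have : (0 : ℝ) < 1 / ((j : ℝ) + 1) / 24 := by positivity
        linarith
      hu := fun ic => by
        have : (0 : ℝ) < 1 / ((j : ℝ) + 1) / 24 := by positivity
        linarith }
  -- the generators
  let gen : ℕ × (Fin (n * 4) → ℤ) × (Fin n × Fin 4 → ℤ) × Finset (Fin n) → 𝓢((Fin n → (EuclideanSpace ℝ (Fin 4))), ℂ) := fun i =>
    SchwartzMap.tensorFin n (fun l => ofRealTest (if l ∈ i.2.2.2
      then reTest ((box i.1 i.2.1).charFactorS (ContinuousLinearEquiv.refl ℝ (EuclideanSpace ℝ (Fin 4))) i.2.2.1 l)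
      else imTest ((box i.1 i.2.1).charFactorS (ContinuousLinearEquiv.refl ℝ (EuclideanSpace ℝ (Fin 4))) i.2.2.1 l)))
  refine ⟨{G | IsOffDiagonal G ∧ ∃ i, gen i = G}, ?_, ?_, ?_⟩
  · exact (Set.countable_range gen).mono fun G hG => by
      obtain ⟨_, i, hi⟩ := hG
      exact ⟨i, hi⟩
  · rintro G ⟨hG, ⟨j, β, nn, t⟩, rfl⟩
    exact ⟨BoxData.boxTensors_subset_tensorProducts _ _ (reImSplit_mem_boxTensors _ (box j β) nn t), hG⟩
  · intro F hF
    obtain ⟨u, -, hsep, hlim⟩ := exists_separated_tendsto_of_isOffDiagonal F hF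
    refine isClosed_closure.mem_of_tendsto hlim (Eventually.of_forall fun m => ?_)
    obtain ⟨δ, hδ, hδsupp⟩ := hsep m
    obtain ⟨j, hj⟩ := exists_nat_one_div_lt hδ
    have hδj : (0 : ℝ) < 1 / ((j : ℝ) + 1) := by positivity
    refine mem_closure_span_of_separated hδj ?_ (hδsupp.trans (separated_anti hj.le))
    intro β B hBl hBu hBl' hBu' nn t hoff
    -- `B` is the box `box j β` (all its fields are determined)
    have hB : B = box j β := by
      cases B with
      | mk l u l' u' hl hl' hu =>
        have el : l = fun ic => ((β (finProdFinEquiv ic) : ℤ) : ℝ) * (1 / ((j : ℝ) + 1) / 24) -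
            2 * (1 / ((j : ℝ) + 1) / 24) := funext hBl
        have eu : u = fun ic => ((β (finProdFinEquiv ic) : ℤ) : ℝ) * (1 / ((j : ℝ) + 1) / 24) +
            2 * (1 / ((j : ℝ) + 1) / 24) := funext hBu
        have el' : l' = fun ic => ((β (finProdFinEquiv ic) : ℤ) : ℝ) * (1 / ((j : ℝ) + 1) / 24) -
            (1 / ((j : ℝ) + 1) / 24) := funext hBl'
        have eu' : u' = fun ic => ((β (finProdFinEquiv ic) : ℤ) : ℝ) * (1 / ((j : ℝ) + 1) / 24) +
            (1 / ((j : ℝ) + 1) / 24) := funext hBu'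
        subst el eu el' eu'
        rfl
    subst hB
    exact ⟨hoff, ⟨j, β, nn, t⟩, rfl⟩

end Summit.QuantumFields.QCD.Cruxes.ThinQCD.Registered

end
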